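import Summits.NavierStokesRegularity.NavierStokesRegularity.Theorems.AdaptedFrequencyFrequencyRigidityFlatReduction
import Summits.NavierStokesRegularity.NavierStokesRegularity.Theorems.AdaptedFrequencyFrequencyRigidityAncientDriftNormalForm
import Summits.NavierStokesRegularity.NavierStokesRegularity.Theorems.AdaptedFrequencyFrequencyRigidityGalileanOseenIdentity
import Summits.NavierStokesRegularity.NavierStokesRegularity.Theorems.AdaptedFrequencyFrequencyRigiditySmallConstantBootstrap
import Summits.NavierStokesRegularity.NavierStokesRegularity.Theorems.AdaptedFrequencyFrequencyRigidityOfLiouville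
import HarnessLib

/-!
# Crux `FrequencyRigidity` (stmt-NavierStokesRegularity-2955), line `two-ended-pinning`:
# the FLAT REDUCTION at skeleton v6 — the crux is EQUIVALENT to its large-constant stub S3L

Helper file (lands `--supports stmt-NavierStokesRegularity-2955`; theorems only).  The landed flat reduction
`stub_flatReduction` (p91321) makes the crux and Stub 3 (`no flat inhabitant`) a checked `↔`.  Skeleton v6 splits Stub 3
by the size of the Type-I constant `C/√ν` against `1/(96 C₀)`, `C₀ = oseenSliceConst ℝ³`, and its small-constant half is
now LANDED (S3a `stub_ancientDriftNormalForm` p107013, S3b `stub_galileanOseenIdentity` p107082, S3c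
`stub_smallConstantBootstrap` p107150).  This file carries the skeleton's glue into the tree:

* `flatEnstrophyLiouville_smallConstant` — no flat inhabitant with `C/√ν < 1/(96 C₀)` (viscosity normalisation
  `classical_viscosityNormalise` of `…OfLiouville.lean`, the drift of S3a, the co-moving identity of S3b, the bootstrap of
  S3c with `A = 9C₁ + 32C₀C₁²`, `C₁ = C/√ν`, `8C₀A < 1`; then `curl v(−1) ≡ 0` and `H(−1) = 0 ≠ A`);
* `flatEnstrophyLiouville_of_largeConstant` — S3L ⇒ Stub 3 (case split);
* `frequencyRigidity_iff_flatEnstrophyLiouville_largeConstant` — **the crux ⇔ S3L** (registered sub-goal): with p91321.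

So the crux is now, as a theorem of the tree, EXACTLY the large-constant Liouville statement S3L — which is implied by
(L) (`…OfLiouville.lean`) and implies bounded-class RSS-Liouville for every `α` (`…WallUnconditional.lean`).

## References

* G. Koch, N. Nadirashvili, G. Seregin, V. Šverák, Acta Math. 203 (2009), §4 p. 8 (the bilinear bound, the gap), §1.
  [KochNadirashviliSereginSverak2009]
-/

set_option linter.dupNamespace false

noncomputable section

namespace Summit.NavierStokesRegularity.NavierStokesRegularity.Theorems.FrequencyRigidity.TwoEndedPinning

open Literature.Analysis Literature.Analysis.FluidPDE MeasureTheory Set Filter Topology Function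

/-- The arithmetic of the threshold: `x < 1/96` forces `8 (9x + 32x²) < 1`. [folklore] -/
private theorem threshold_arith {x : ℝ} (hx0 : 0 ≤ x) (hx : x < 1 / 96) :
    8 * (9 * x + 32 * x ^ 2) < 1 := by
  nlinarith

/-- **No flat inhabitant with a SMALL Type-I constant `C/√ν < 1/(96 C₀)`** (the small-constant half of Stub 3, from the
landed S3a + S3b + S3c): normalise the viscosity (`w(s,y) = ν^{−1/2}v(s, √ν y)`, Type-I constant `C₁ = C/√ν`), take the
normalised drift `β` of S3a (`‖β‖ ≤ (8C₁ + 32C₀C₁²)/√(−t)`), so that `‖w − β‖ ≤ A/√(−t)` with `A = 9C₁ + 32C₀C₁²` and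
`8C₀A < 1`; S3b feeds S3c, whence `w(t,·) ≡ β(t)`, the slices of `v` are constant, `curl v(−1) ≡ 0` and `H(−1) = 0`,
contradicting `H(−1) = A > 0`. [cite: KochNadirashviliSereginSverak2009, §4 p. 8 (arXiv:0709.3599)] -/
theorem flatEnstrophyLiouville_smallConstant
    (ν C A : ℝ) (C' : ℕ → ℝ) (v : ℝ → EuclideanSpace ℝ (Fin 3) → EuclideanSpace ℝ (Fin 3))
    (q : ℝ → EuclideanSpace ℝ (Fin 3) → ℝ) (K : ℝ → EuclideanSpace ℝ (Fin 3) → ℝ)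
    (hsmall : C / Real.sqrt ν < 1 / (96 * oseenSliceConst (EuclideanSpace ℝ (Fin 3)))) :
    ¬ (0 < ν ∧ Literature.Analysis.FluidPDE.IsClassicalNSSolutionOn (Set.Iio 0) ν 0 v q ∧
          Literature.Analysis.FluidPDE.HasTypeITimeDecay C v ∧
          (∀ k : ℕ, 1 ≤ k → ∀ t : ℝ, t < 0 → ∀ x : EuclideanSpace ℝ (Fin 3),
            ‖iteratedFDeriv ℝ k (v t) x‖ ≤ C' k * (-t) ^ (-((k : ℝ) + 1) / 2)) ∧
          Literature.Analysis.FluidPDE.IsAdaptedBackwardKernel ν v (Set.Iio 0) 0 0 K ∧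
          Literature.Analysis.FluidPDE.IsGaussianComparable K (Set.Iio 0) 0 0 ∧ 0 < A ∧
          (∀ t : ℝ, t < 0 →
            Literature.Analysis.FluidPDE.adaptedEnstrophy v K t = A * (-t) ^ (-(2 : ℝ))) ∧
          (∀ t : ℝ, t < 0 →
            HasDerivAt (Literature.Analysis.FluidPDE.adaptedEnstrophy v K)
              (∫ x, (2 * (inner ℝ (Literature.Analysis.FluidPDE.curl (v t) x)
                            (fderiv ℝ (v t) x (Literature.Analysis.FluidPDE.curl (v t) x))
                          - ν * Literature.Analysis.FluidPDE.frobeniusNormSq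
                            (fderiv ℝ (Literature.Analysis.FluidPDE.curl (v t)) x))) * K t x) t)) := by
  rintro ⟨hν, hNS, hTI, -, -, -, hA, hflat, -⟩
  set m : ℝ := Real.sqrt ν with hm
  have hm0 : 0 < m := Real.sqrt_pos.2 hν
  have hC₀ : 0 < oseenSliceConst (EuclideanSpace ℝ (Fin 3)) := oseenSliceConst_pos
  have hC0 : 0 ≤ C := by
    have h1 := hTI (-1) (by norm_num) 0
    have h2 : (0 : ℝ) ≤ C / Real.sqrt (-(-1:ℝ)) := (norm_nonneg _).trans h1
    simpa using h2
  -- ## the normalised flow `w`, Type-I with constant `C₁ = C/m`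
  set C₁ : ℝ := C / m with hC₁
  have hC₁0 : 0 ≤ C₁ := div_nonneg hC0 hm0.le
  set w : ℝ → (EuclideanSpace ℝ (Fin 3)) → (EuclideanSpace ℝ (Fin 3)) := m⁻¹ • stPull 1 m 0 0 v with hw_def
  have hw : IsClassicalNSSolutionOn (Iio 0) 1 0 w ((m⁻¹ ^ 2) • stPull 1 m 0 0 q) :=
    classical_viscosityNormalise hν hNS
  have hw_apply : ∀ s y, w s y = m⁻¹ • v s (m • y) := by
    intro s y
    simp [hw_def, stPull]
  have hwTI : HasTypeITimeDecay C₁ w := by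
    intro s hs y
    rw [hw_apply, norm_smul, Real.norm_of_nonneg (inv_nonneg.2 hm0.le), hC₁, div_div,
      mul_comm m, ← div_div, div_eq_inv_mul]
    exact mul_le_mul_of_nonneg_left (hTI s hs (m • y)) (inv_nonneg.2 hm0.le)
  -- ## the drift and the co-moving identity
  obtain ⟨β, hβc, hβb, hid⟩ := stub_ancientDriftNormalForm C₁ w _ hw hwTI
  have hgal := stub_galileanOseenIdentity C₁ w _ β hw hwTI hβc hid
  -- ## the constant `A₀ = 9C₁ + 32C₀C₁²` and the threshold
  set A₀ : ℝ := 9 * C₁ + 32 * oseenSliceConst (EuclideanSpace ℝ (Fin 3)) * C₁ ^ 2 with hA₀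
  have hA₀0 : 0 ≤ A₀ := by rw [hA₀]; positivity
  have hx : oseenSliceConst (EuclideanSpace ℝ (Fin 3)) * C₁ < 1 / 96 := by
    have h1 : C₁ < 1 / (96 * oseenSliceConst (EuclideanSpace ℝ (Fin 3))) := hsmall
    rw [lt_div_iff₀ (by positivity)] at h1
    rw [lt_div_iff₀ (by norm_num : (0:ℝ) < 96)]
    linarith
  have hthr : 8 * oseenSliceConst (EuclideanSpace ℝ (Fin 3)) * A₀ < 1 := by
    have key := threshold_arith (mul_nonneg hC₀.le hC₁0) hx
    have e : 8 * oseenSliceConst (EuclideanSpace ℝ (Fin 3)) * A₀ =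
        8 * (9 * (oseenSliceConst (EuclideanSpace ℝ (Fin 3)) * C₁) + 32 * (oseenSliceConst (EuclideanSpace ℝ (Fin 3)) * C₁) ^ 2) := by
      rw [hA₀]; ring
    rw [e]; exact key
  have hbound : ∀ τ : ℝ, τ < 0 → ∀ y : (EuclideanSpace ℝ (Fin 3)), ‖w τ y - β τ‖ ≤ A₀ / Real.sqrt (-τ) := by
    intro τ hτ y
    have h1 := hwTI τ hτ y
    have h2 := hβb τ hτ
    have hsq : 0 < Real.sqrt (-τ) := Real.sqrt_pos.2 (by linarith)
    calc ‖w τ y - β τ‖ ≤ ‖w τ y‖ + ‖β τ‖ := norm_sub_le _ _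
      _ ≤ C₁ / Real.sqrt (-τ) + (8 * C₁ + 32 * oseenSliceConst (EuclideanSpace ℝ (Fin 3)) * C₁ ^ 2) / Real.sqrt (-τ) :=
          add_le_add h1 h2
      _ = A₀ / Real.sqrt (-τ) := by rw [hA₀]; field_simp; ring
  -- ## the bootstrap: `w(t, ·) ≡ β(t)`
  have hconst := stub_smallConstantBootstrap A₀ w β hA₀0 hthr hbound hgal
  -- ## back to `v`: constant slices, `curl v(−1) = 0`, `H(−1) = 0 ≠ A`
  have hv : ∀ x, v (-1) x = m • β (-1) := by
    intro x
    have h1 := hconst (-1) (by norm_num) (m⁻¹ • x)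
    rw [hw_apply, smul_smul, mul_inv_cancel₀ hm0.ne', one_smul] at h1
    rw [← h1, smul_smul, mul_inv_cancel₀ hm0.ne', one_smul]
  have hc : ∀ x, curl (v (-1)) x = 0 := by
    intro x
    have e : v (-1) = fun _ => m • β (-1) := funext hv
    rw [e]; simp [curl]
  have h1 := hflat (-1) (by norm_num)
  have hzero : adaptedEnstrophy v K (-1) = 0 := by
    simp [adaptedEnstrophy, hc]
  rw [hzero] at h1
  norm_num at h1
  linarith

/-- **S3L ⇒ Stub 3**: the large-constant stub of skeleton v6 implies the planner's Stub 3 (no flat inhabitant), by the case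
split `C/√ν < 1/(96C₀)` (landed small-constant half) or `≥` (S3L). -/
theorem flatEnstrophyLiouville_of_largeConstant
    (h3L : ∀ (ν C A : ℝ) (C' : ℕ → ℝ) (v : ℝ → EuclideanSpace ℝ (Fin 3) → EuclideanSpace ℝ (Fin 3))
      (q : ℝ → EuclideanSpace ℝ (Fin 3) → ℝ) (K : ℝ → EuclideanSpace ℝ (Fin 3) → ℝ),
      1 / (96 * Literature.Analysis.FluidPDE.oseenSliceConst (EuclideanSpace ℝ (Fin 3))) ≤ C / Real.sqrt ν →
      ¬ (0 < ν ∧ Literature.Analysis.FluidPDE.IsClassicalNSSolutionOn (Set.Iio 0) ν 0 v q ∧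
          Literature.Analysis.FluidPDE.HasTypeITimeDecay C v ∧
          (∀ k : ℕ, 1 ≤ k → ∀ t : ℝ, t < 0 → ∀ x : EuclideanSpace ℝ (Fin 3),
            ‖iteratedFDeriv ℝ k (v t) x‖ ≤ C' k * (-t) ^ (-((k : ℝ) + 1) / 2)) ∧
          Literature.Analysis.FluidPDE.IsAdaptedBackwardKernel ν v (Set.Iio 0) 0 0 K ∧
          Literature.Analysis.FluidPDE.IsGaussianComparable K (Set.Iio 0) 0 0 ∧ 0 < A ∧
          (∀ t : ℝ, t < 0 →
            Literature.Analysis.FluidPDE.adaptedEnstrophy v K t = A * (-t) ^ (-(2 : ℝ))) ∧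
          (∀ t : ℝ, t < 0 →
            HasDerivAt (Literature.Analysis.FluidPDE.adaptedEnstrophy v K)
              (∫ x, (2 * (inner ℝ (Literature.Analysis.FluidPDE.curl (v t) x)
                            (fderiv ℝ (v t) x (Literature.Analysis.FluidPDE.curl (v t) x))
                          - ν * Literature.Analysis.FluidPDE.frobeniusNormSq
                            (fderiv ℝ (Literature.Analysis.FluidPDE.curl (v t)) x))) * K t x) t))) :
    ∀ (ν C A : ℝ) (C' : ℕ → ℝ) (v : ℝ → EuclideanSpace ℝ (Fin 3) → EuclideanSpace ℝ (Fin 3))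
      (q : ℝ → EuclideanSpace ℝ (Fin 3) → ℝ) (K : ℝ → EuclideanSpace ℝ (Fin 3) → ℝ),
      ¬ (0 < ν ∧ Literature.Analysis.FluidPDE.IsClassicalNSSolutionOn (Set.Iio 0) ν 0 v q ∧
          Literature.Analysis.FluidPDE.HasTypeITimeDecay C v ∧
          (∀ k : ℕ, 1 ≤ k → ∀ t : ℝ, t < 0 → ∀ x : EuclideanSpace ℝ (Fin 3),
            ‖iteratedFDeriv ℝ k (v t) x‖ ≤ C' k * (-t) ^ (-((k : ℝ) + 1) / 2)) ∧
          Literature.Analysis.FluidPDE.IsAdaptedBackwardKernel ν v (Set.Iio 0) 0 0 K ∧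
          Literature.Analysis.FluidPDE.IsGaussianComparable K (Set.Iio 0) 0 0 ∧ 0 < A ∧
          (∀ t : ℝ, t < 0 →
            Literature.Analysis.FluidPDE.adaptedEnstrophy v K t = A * (-t) ^ (-(2 : ℝ))) ∧
          (∀ t : ℝ, t < 0 →
            HasDerivAt (Literature.Analysis.FluidPDE.adaptedEnstrophy v K)
              (∫ x, (2 * (inner ℝ (Literature.Analysis.FluidPDE.curl (v t) x)
                            (fderiv ℝ (v t) x (Literature.Analysis.FluidPDE.curl (v t) x))
                          - ν * Literature.Analysis.FluidPDE.frobeniusNormSq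
                            (fderiv ℝ (Literature.Analysis.FluidPDE.curl (v t)) x))) * K t x) t)) := by
  intro ν C A C' v q K h
  rcases lt_or_ge (C / Real.sqrt ν) (1 / (96 * oseenSliceConst (EuclideanSpace ℝ (Fin 3)))) with hs | hl
  · exact flatEnstrophyLiouville_smallConstant ν C A C' v q K hs h
  · exact h3L ν C A C' v q K hl h

/-- **THE FLAT REDUCTION AT v6 — the crux ⇔ its large-constant stub S3L** (registered sub-goal
`frequencyRigidity_iff_flatEnstrophyLiouville_largeConstant`): `→` by the landed `stub_flatReduction` (p91321, crux ⇒ Stub 3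
⇒ S3L by weakening); `←` by `flatEnstrophyLiouville_of_largeConstant` and `frequencyRigidity_of_flatEnstrophyLiouville`. -/
theorem frequencyRigidity_iff_flatEnstrophyLiouville_largeConstant :
    Summit.NavierStokesRegularity.NavierStokesRegularity.Theses.AdaptedFrequency.FrequencyRigidity ↔ ∀ (ν C A : ℝ) (C' : ℕ → ℝ) (v : ℝ → EuclideanSpace ℝ (Fin 3) → EuclideanSpace ℝ (Fin 3))
      (q : ℝ → EuclideanSpace ℝ (Fin 3) → ℝ) (K : ℝ → EuclideanSpace ℝ (Fin 3) → ℝ),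
      1 / (96 * Literature.Analysis.FluidPDE.oseenSliceConst (EuclideanSpace ℝ (Fin 3))) ≤ C / Real.sqrt ν →
      ¬ (0 < ν ∧ Literature.Analysis.FluidPDE.IsClassicalNSSolutionOn (Set.Iio 0) ν 0 v q ∧
          Literature.Analysis.FluidPDE.HasTypeITimeDecay C v ∧
          (∀ k : ℕ, 1 ≤ k → ∀ t : ℝ, t < 0 → ∀ x : EuclideanSpace ℝ (Fin 3),
            ‖iteratedFDeriv ℝ k (v t) x‖ ≤ C' k * (-t) ^ (-((k : ℝ) + 1) / 2)) ∧
          Literature.Analysis.FluidPDE.IsAdaptedBackwardKernel ν v (Set.Iio 0) 0 0 K ∧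
          Literature.Analysis.FluidPDE.IsGaussianComparable K (Set.Iio 0) 0 0 ∧ 0 < A ∧
          (∀ t : ℝ, t < 0 →
            Literature.Analysis.FluidPDE.adaptedEnstrophy v K t = A * (-t) ^ (-(2 : ℝ))) ∧
          (∀ t : ℝ, t < 0 →
            HasDerivAt (Literature.Analysis.FluidPDE.adaptedEnstrophy v K)
              (∫ x, (2 * (inner ℝ (Literature.Analysis.FluidPDE.curl (v t) x)
                            (fderiv ℝ (v t) x (Literature.Analysis.FluidPDE.curl (v t) x))
                          - ν * Literature.Analysis.FluidPDE.frobeniusNormSq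
                            (fderiv ℝ (Literature.Analysis.FluidPDE.curl (v t)) x))) * K t x) t)) := by
  constructor
  · intro h ν C A C' v q K _ hconj
    exact (stub_flatReduction.1 h) ν C A C' v q K hconj
  · intro h3L
    exact frequencyRigidity_of_flatEnstrophyLiouville (flatEnstrophyLiouville_of_largeConstant h3L)

end Summit.NavierStokesRegularity.NavierStokesRegularity.Theorems.FrequencyRigidity.TwoEndedPinning

end
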